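import Summits.RiemannHypothesis.RiemannHypothesis.Theorems.HandoffDodgerAsymptoticsD
import Summits.RiemannHypothesis.RiemannHypothesis.Theorems.HandoffDodgerAsymptoticsE
import HarnessLib

/-!
# HANDOFF — ASYMPTOTICS (F): cost ≤ 18400(b+4)e^{−2b} < 6.2·10⁻⁷e^{−52b/43}/(2b+1)² ≤ gain (rh-explicit, track «HANDOFF», seat prove-2 gen10, ATTEMPT-19 §8 (P7))

HONEST FRAMING. Nothing here bears on the truth of RH; elementary real inequalities (Mathlib + part (E)). In the abstract
variables of part (E) we assemble the total cost bound, the total gain bound and the exponential domination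
`2.96·10¹⁰(b+4)(2b+1)² < e^{34b/43}` (`b ≥ 100`, via `u²⁰/20! ≤ e^u`), giving the comparison `hlt` of `dodger_witness_explicit`
in abstract form (`cost_lt_gain`). No `sorry`, standard axioms.

References: this track (ATTEMPT-16 THEOREM 16.2; ATTEMPT-19 §8 (P7)).
-/

set_option linter.dupNamespace false

noncomputable section

open Real

namespace Summit.RiemannHypothesis.RiemannHypothesis.Theorems.Handoff

set_option maxHeartbeats 400000 in
/-- **Total cost.** [this track, ATTEMPT-19 §8 (P7)] -/
theorem cost_le {T b k cI cL xL δU : ℝ} (hb : 100 ≤ b) (hT : 110000 * (b + 1) ^ 2 ≤ T)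
    (hTT₀ : T ≤ 2 * π * Real.exp (1 + 2 * b)) (hT₀T : 2 * π * Real.exp (1 + 2 * b) ≤ 101 / 100 * T)
    (hk2 : 2 ≤ k) (hk : k ≤ 2 / 5 * b * T)
    (hcI : T ^ 3 / (19 * π) ≤ cI) (hcI2 : cI ≤ T ^ 3) (hcL : cL = 4 * cI) (hxL : xL = Real.sqrt (cL / 4))
    (hδ0 : 0 ≤ δU) (hδ1 : δU ≤ 1) :
    2 * (4 * (Real.sinh (δU / 2) ^ 2 + 1) * Real.exp 1 * (4 * Real.cosh (b / 2) ^ 2 * (1 + b) ^ 2 / b ^ 2)) *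
        (((2 * T) / (2 * π) * Real.log ((2 * T) / (2 * π * Real.exp 1)) +
              (0.1038 * Real.log (2 * T) + 0.2573 * Real.log (Real.log (2 * T)) + 9.3675)) / T ^ 2 *
            Real.exp (4 * (b / π * (1 + Real.log (k - 1))) - cL / (2 * T + 1) ^ 2) +
          Real.exp (144 * (2 * k) ^ 2 / (7 * cL)) * (Real.log xL / (Real.exp 1 * xL) + 220 * (Real.log xL + 1) / xL)) ≤
      18400 * (b + 4) / Real.exp (2 * b) := by
  have hπ3 : 3 < π := Real.pi_gt_three
  have hb0 : 0 < b := by linarith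
  have hT0 : 0 < T := by nlinarith
  have hP := cost_prefactor_le hδ0 hδ1 hb
  have hF := cost_first_le hb hT hTT₀ hk2 hk hcI hcL
  have hS := cost_second_le hb hT hTT₀ hk2 hk hcI hcI2 hcL hxL
  have hTs : 0 < T * Real.sqrt T := by positivity
  -- `T√T ≥ 69.5·e^b·e^{2b}`
  set Eb := Real.exp b with hEb
  have hEb0 : 0 < Eb := Real.exp_pos b
  have hE2 : Real.exp (2 * b) = Eb ^ 2 := by rw [hEb, ← Real.exp_nat_mul]; ring_nf
  have hT16 : 16.9 * Eb ^ 2 ≤ T := by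
    have e1 : Real.exp (1 + 2 * b) = Real.exp 1 * Eb ^ 2 := by rw [Real.exp_add, hE2]
    rw [e1] at hT₀T
    have h2πe : 17.079 ≤ 2 * π * Real.exp 1 := by
      have hp := Real.pi_gt_d6
      have he := Real.exp_one_gt_d9
      nlinarith only [hp, he]
    have := mul_le_mul_of_nonneg_right h2πe (pow_pos hEb0 2).le
    nlinarith only [this, hT₀T]
  have hsq : 4.11 * Eb ≤ Real.sqrt T := by
    rw [Real.le_sqrt (by positivity) hT0.le]; nlinarith only [hT16, pow_pos hEb0 2]
  have hTs2 : 69.4 * Eb * Eb ^ 2 ≤ T * Real.sqrt T := by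
    have := mul_le_mul hT16 hsq (by positivity) hT0.le; nlinarith only [this, pow_pos hEb0 3]
  have hsum : ((2 * T) / (2 * π) * Real.log ((2 * T) / (2 * π * Real.exp 1)) +
              (0.1038 * Real.log (2 * T) + 0.2573 * Real.log (Real.log (2 * T)) + 9.3675)) / T ^ 2 *
            Real.exp (4 * (b / π * (1 + Real.log (k - 1))) - cL / (2 * T + 1) ^ 2) +
          Real.exp (144 * (2 * k) ^ 2 / (7 * cL)) * (Real.log xL / (Real.exp 1 * xL) + 220 * (Real.log xL + 1) / xL) ≤
        5251 * (b + 4) / (69.4 * Eb * Eb ^ 2) := by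
    have h1 : 1 / (T * Real.sqrt T) + 5250 * (b + 4) / (T * Real.sqrt T) ≤ 5251 * (b + 4) / (T * Real.sqrt T) := by
      rw [← add_div]; exact div_le_div_of_nonneg_right (by linarith) hTs.le
    have h2 : 5251 * (b + 4) / (T * Real.sqrt T) ≤ 5251 * (b + 4) / (69.4 * Eb * Eb ^ 2) :=
      div_le_div_of_nonneg_left (by positivity) (by positivity) hTs2
    linarith
  have hsum0 : 0 ≤ 5251 * (b + 4) / (69.4 * Eb * Eb ^ 2) := by positivity
  calc 2 * (4 * (Real.sinh (δU / 2) ^ 2 + 1) * Real.exp 1 * (4 * Real.cosh (b / 2) ^ 2 * (1 + b) ^ 2 / b ^ 2)) *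
        (((2 * T) / (2 * π) * Real.log ((2 * T) / (2 * π * Real.exp 1)) +
              (0.1038 * Real.log (2 * T) + 0.2573 * Real.log (Real.log (2 * T)) + 9.3675)) / T ^ 2 *
            Real.exp (4 * (b / π * (1 + Real.log (k - 1))) - cL / (2 * T + 1) ^ 2) +
          Real.exp (144 * (2 * k) ^ 2 / (7 * cL)) * (Real.log xL / (Real.exp 1 * xL) + 220 * (Real.log xL + 1) / xL))
      ≤ 2 * (4 * (Real.sinh (δU / 2) ^ 2 + 1) * Real.exp 1 * (4 * Real.cosh (b / 2) ^ 2 * (1 + b) ^ 2 / b ^ 2)) *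
        (5251 * (b + 4) / (69.4 * Eb * Eb ^ 2)) := mul_le_mul_of_nonneg_left hsum (by positivity)
    _ ≤ 2 * (121 * Eb) * (5251 * (b + 4) / (69.4 * Eb * Eb ^ 2)) :=
        mul_le_mul_of_nonneg_right (by linarith) hsum0
    _ = 2 * 121 * 5251 / 69.4 * (b + 4) / Eb ^ 2 := by field_simp
    _ ≤ 18400 * (b + 4) / Real.exp (2 * b) := by
        rw [hE2]; apply div_le_div_of_nonneg_right _ (by positivity); nlinarith

/-- **Total gain.** [this track, ATTEMPT-19 §8 (P7)] -/
theorem gain_ge {b L Q δL r κ y pU T Φ : ℝ} (hb : 100 ≤ b) (hL1 : 2 * b ≤ L) (hL2 : L ≤ 2 * b + 1)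
    (hQ0 : 0 < Q) (hQ : Q ≤ 1.011 * Real.exp b) (hκ : 1 / 2 ≤ κ) (hr : 6 * r ≤ δL)
    (hy : y = 3 / 5 * (L * Real.sqrt L)) (hδL : δL = y / Real.sqrt pU) (hpU0 : 0 < pU)
    (hpU : pU ≤ 41 / 100 * b * T ^ 3) (hT0 : 0 < T) (hTT₀ : T ≤ 2 * π * Real.exp (1 + 2 * b))
    (hΦ : Real.exp (30 * L / 43 - 3) / (3 * L) ≤ Φ) :
    6.2e-7 * Real.exp (34 * b / 43) / ((2 * b + 1) ^ 2 * Real.exp (2 * b)) ≤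
      2 * L / Q * ((δL - 3 * r) / 2 * (κ ^ 2 / (4 * b ^ 2)) * Φ ^ 2) := by
  have hπ4 : π < 3.1416 := Real.pi_lt_d4
  have hb0 : 0 < b := by linarith
  have hL0 : 0 < L := by linarith
  set Eb := Real.exp b with hEb
  have hEb0 : 0 < Eb := Real.exp_pos b
  have hE2 : Real.exp (2 * b) = Eb ^ 2 := by rw [hEb, ← Real.exp_nat_mul]; ring_nf
  set G := Real.exp (34 * b / 43) with hG
  have hG0 : 0 < G := Real.exp_pos _
  -- `T ≤ 17.1·Eb²`
  have hT17 : T ≤ 17.1 * Eb ^ 2 := by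
    have e1 : Real.exp (1 + 2 * b) = Real.exp 1 * Eb ^ 2 := by rw [Real.exp_add, hE2]
    rw [e1] at hTT₀
    have h2πe : 2 * π * Real.exp 1 ≤ 17.1 := by
      have he := Real.exp_one_lt_d9
      nlinarith only [hπ4, he, Real.exp_pos 1, Real.pi_pos]
    have := mul_le_mul_of_nonneg_right h2πe (pow_pos hEb0 2).le
    nlinarith only [this, hTT₀]
  -- `δL ≥ D = 0.037·b/Eb³`
  have hy0 : 0 ≤ y := by rw [hy]; positivity
  have hy2 : y ^ 2 = 9 / 25 * L ^ 3 := by rw [hy, mul_pow, mul_pow, Real.sq_sqrt hL0.le]; ring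
  set D : ℝ := 0.037 * b / Eb ^ 3 with hD
  have hD0 : 0 ≤ D := by positivity
  have hDδ : D ≤ δL := by
    have e : δL = Real.sqrt (y ^ 2 / pU) := by rw [hδL, Real.sqrt_div (sq_nonneg y), Real.sqrt_sq hy0]
    rw [e, Real.le_sqrt hD0 (by positivity), hD, div_pow, div_le_div_iff₀ (by positivity) hpU0, hy2]
    have hT3 : T ^ 3 ≤ (17.1 * Eb ^ 2) ^ 3 := pow_le_pow_left₀ hT0.le hT17 3
    have h1 : (0.037 * b) ^ 2 * pU ≤ (0.037 * b) ^ 2 * (41 / 100 * b * (17.1 * Eb ^ 2) ^ 3) := by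
      apply mul_le_mul_of_nonneg_left _ (by positivity); nlinarith only [hpU, hT3, hb0]
    have h2 : (2 * b) ^ 3 ≤ L ^ 3 := pow_le_pow_left₀ (by positivity) hL1 3
    have h3 : (0.037 * b) ^ 2 * (41 / 100 * b * (17.1 * Eb ^ 2) ^ 3) ≤ 9 / 25 * (2 * b) ^ 3 * (Eb ^ 3) ^ 2 := by
      have : 0 ≤ b ^ 3 * Eb ^ 6 := by positivity
      nlinarith only [this]
    have h4 : 9 / 25 * (2 * b) ^ 3 * (Eb ^ 3) ^ 2 ≤ 9 / 25 * L ^ 3 * (Eb ^ 3) ^ 2 := by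
      nlinarith only [h2, pow_pos hEb0 3]
    linarith only [h1, h3, h4]
  -- the profile value
  set Φ₁ : ℝ := Real.exp (60 * b / 43 - 3) / (3 * (2 * b + 1)) with hΦ₁
  have hΦ₁0 : 0 < Φ₁ := by positivity
  have hΦ₁le : Φ₁ ≤ Φ := by
    refine le_trans ?_ hΦ
    rw [hΦ₁]
    exact div_le_div₀ (Real.exp_pos _).le (Real.exp_le_exp.2 (by linarith only [hL1])) (by positivity)
      (by linarith only [hL2])
  have hΦ₁sq : Φ₁ ^ 2 = Eb ^ 2 * G / Real.exp 6 / (9 * (2 * b + 1) ^ 2) := by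
    rw [hΦ₁, div_pow, ← Real.exp_nat_mul]
    have : ((2 : ℕ) : ℝ) * (60 * b / 43 - 3) = 2 * b + 34 * b / 43 - 6 := by push_cast; ring
    rw [this, Real.exp_sub, Real.exp_add, hE2]; ring
  -- factor lower bounds
  have A1 : 4 * b / (1.011 * Eb) ≤ 2 * L / Q := by
    rw [div_le_div_iff₀ (by positivity) hQ0]
    have := mul_le_mul_of_nonneg_left hQ hb0.le
    nlinarith only [this, hL1, hEb0]
  have A2 : D / 4 ≤ (δL - 3 * r) / 2 := by linarith only [hDδ, hr]
  have A3 : 1 / (16 * b ^ 2) ≤ κ ^ 2 / (4 * b ^ 2) := by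
    rw [div_le_div_iff₀ (by positivity) (by positivity)]
    have hκ2 : 1 / 4 ≤ κ ^ 2 := by nlinarith only [hκ]
    nlinarith only [mul_le_mul_of_nonneg_right hκ2 (sq_nonneg b)]
  have A4 : Φ₁ ^ 2 ≤ Φ ^ 2 := pow_le_pow_left₀ hΦ₁0.le hΦ₁le 2
  have B1 : D / 4 * (1 / (16 * b ^ 2)) ≤ (δL - 3 * r) / 2 * (κ ^ 2 / (4 * b ^ 2)) :=
    mul_le_mul A2 A3 (by positivity) (by linarith only [A2, hD0])
  have B2 : D / 4 * (1 / (16 * b ^ 2)) * Φ₁ ^ 2 ≤ (δL - 3 * r) / 2 * (κ ^ 2 / (4 * b ^ 2)) * Φ ^ 2 :=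
    mul_le_mul B1 A4 (by positivity) (mul_nonneg (by linarith only [A2, hD0]) (by positivity))
  have B3 : 4 * b / (1.011 * Eb) * (D / 4 * (1 / (16 * b ^ 2)) * Φ₁ ^ 2) ≤
      2 * L / Q * ((δL - 3 * r) / 2 * (κ ^ 2 / (4 * b ^ 2)) * Φ ^ 2) :=
    mul_le_mul A1 B2 (by positivity) (by positivity)
  refine le_trans ?_ B3
  rw [hΦ₁sq, hD, hE2]
  have e6 : Real.exp 6 < 403.5 := by
    have h6 : Real.exp 6 = Real.exp 4 * Real.exp 2 := by rw [← Real.exp_add]; norm_num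
    rw [h6]; nlinarith [exp_numerics.2.2.1, exp_numerics.1, Real.exp_pos 4, Real.exp_pos 2]
  have h6 : 0 < Real.exp 6 := Real.exp_pos 6
  rw [show 4 * b / (1.011 * Eb) * (0.037 * b / Eb ^ 3 / 4 * (1 / (16 * b ^ 2)) * (Eb ^ 2 * G / Real.exp 6 / (9 * (2 * b + 1) ^ 2)))
      = (0.037 / (1.011 * 16 * 9)) / Real.exp 6 * (G / ((2 * b + 1) ^ 2 * Eb ^ 2)) by field_simp]
  rw [mul_div_assoc]
  apply mul_le_mul_of_nonneg_right _ (by positivity)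
  rw [le_div_iff₀ h6]; nlinarith only [e6]

/-- **Exponential domination.** `b ≥ 100` ⟹ `2.97·10¹⁰(b+4)(2b+1)² ≤ e^{34b/43}` (via `u²⁰/20! ≤ e^u`). [this track, ATTEMPT-19 §8 (P7)] -/
theorem exp_dominates {b : ℝ} (hb : 100 ≤ b) : 2.97e10 * ((b + 4) * (2 * b + 1) ^ 2) ≤ Real.exp (34 * b / 43) := by
  have h := Real.pow_div_factorial_le_exp (34 * b / 43) (by positivity) 20
  norm_num [Nat.factorial] at h
  refine le_trans ?_ h
  have h1 : (100 : ℝ) ^ 17 ≤ b ^ 17 := pow_le_pow_left₀ (by norm_num) hb 17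
  have h2 : (b + 4) * (2 * b + 1) ^ 2 ≤ 4.21 * b ^ 3 := by
    have a1 := mul_nonneg (sq_nonneg b) (by linarith : 0 ≤ b - 100)
    have a2 := mul_nonneg (by linarith : (0:ℝ) ≤ b) (by linarith : 0 ≤ b - 100)
    nlinarith only [a1, a2, hb]
  have h3 : (34 * b / 43) ^ 20 = (34 / 43) ^ 20 * (b ^ 17 * b ^ 3) := by ring
  have hb3 : 0 ≤ b ^ 3 := by positivity
  have h4 := mul_le_mul_of_nonneg_right h1 hb3
  rw [h3]
  nlinarith only [h2, h4, hb3]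

set_option maxHeartbeats 400000 in
/-- **The comparison (abstract form of `hlt`).** [this track, ATTEMPT-16 THEOREM 16.2; ATTEMPT-19 §8 (P7)] -/
theorem cost_lt_gain {T b k cI cL xL δU L Q δL r κ y pU Φ : ℝ} (hb : 100 ≤ b) (hL1 : 2 * b ≤ L) (hL2 : L ≤ 2 * b + 1)
    (hTe : Real.exp (2 * b) ≤ T) (hTT₀ : T ≤ 2 * π * Real.exp (1 + 2 * b)) (hT₀T : 2 * π * Real.exp (1 + 2 * b) ≤ 101 / 100 * T)
    (hk2 : 2 ≤ k) (hk : k ≤ 2 / 5 * b * T)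
    (hcI : T ^ 3 / (19 * π) ≤ cI) (hcI2 : cI ≤ T ^ 3) (hcL : cL = 4 * cI) (hxL : xL = Real.sqrt (cL / 4))
    (hδ0 : 0 ≤ δU) (hδ1 : δU ≤ 1)
    (hQ0 : 0 < Q) (hQ : Q ≤ 1.011 * Real.exp b) (hκ : 1 / 2 ≤ κ) (hr : 6 * r ≤ δL)
    (hy : y = 3 / 5 * (L * Real.sqrt L)) (hδL : δL = y / Real.sqrt pU) (hpU0 : 0 < pU)
    (hpU : pU ≤ 41 / 100 * b * T ^ 3) (hΦ : Real.exp (30 * L / 43 - 3) / (3 * L) ≤ Φ) :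
    2 * (4 * (Real.sinh (δU / 2) ^ 2 + 1) * Real.exp 1 * (4 * Real.cosh (b / 2) ^ 2 * (1 + b) ^ 2 / b ^ 2)) *
        (((2 * T) / (2 * π) * Real.log ((2 * T) / (2 * π * Real.exp 1)) +
              (0.1038 * Real.log (2 * T) + 0.2573 * Real.log (Real.log (2 * T)) + 9.3675)) / T ^ 2 *
            Real.exp (4 * (b / π * (1 + Real.log (k - 1))) - cL / (2 * T + 1) ^ 2) +
          Real.exp (144 * (2 * k) ^ 2 / (7 * cL)) * (Real.log xL / (Real.exp 1 * xL) + 220 * (Real.log xL + 1) / xL)) <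
      2 * L / Q * ((δL - 3 * r) / 2 * (κ ^ 2 / (4 * b ^ 2)) * Φ ^ 2) := by
  have hT := horizon_master hb hTe
  have hT0 : 0 < T := by nlinarith
  have hC := cost_le hb hT hTT₀ hT₀T hk2 hk hcI hcI2 hcL hxL hδ0 hδ1
  have hG := gain_ge hb hL1 hL2 hQ0 hQ hκ hr hy hδL hpU0 hpU hT0 hTT₀ hΦ
  have hD := exp_dominates hb
  refine lt_of_le_of_lt hC (lt_of_lt_of_le ?_ hG)
  have hE := Real.exp_pos (2 * b)
  rw [div_lt_div_iff₀ hE (by positivity)]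
  have hpos : 0 < (b + 4) * Real.exp (2 * b) := by positivity
  nlinarith [mul_le_mul_of_nonneg_right hD hpos.le]

end Summit.RiemannHypothesis.RiemannHypothesis.Theorems.Handoff
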